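import Literature.Probability.LatticeModels.RandomClusterBoundaryPushingTools
import Literature.Probability.LatticeModels.RandomClusterClosedCut
import HarnessLib

/-!
# Pushing boundary conditions across a collar with an inner wired blob: the two steps (proved)

Topic `Literature/Probability/LatticeModels` (trunk `StatMech`, family `crit-ising`). Steps of the
monotone boundary-condition toolkit WITH AN INNER WIRED BLOB (H. Kesten, *The incipient infinite
cluster in two-dimensional percolation*, PTRF 73 (1986), proof of Lemma (23), eq. (31): "the
boundary condition far away changes the probability of an inner event only by a bounded factor"),
for the finite-graph random-cluster measure `φ^B_{G,p,q} = rcMeasure G p q B` of the graph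
`⟨E⟩ = fromEdgeSet ↑E` spanned by a finite edge set `E`, without planarity, consumed by
`RandomClusterBlobPushing.lean`. The geometry is the abstract collar of
`RandomClusterBoundaryPushingTools.lean`: a CORE vertex set, a disjoint COLLAR `Ann` such that every
`E`-edge at a core vertex has both endpoints in `Core ∪ Ann`, `EA` = the `E`-edges touching the
collar; a RADIAL CROSSING is an `⟨E⟩`-walk from `Core` to the outside of `Core ∪ Ann` with interior
in `Ann` and open edges.

* `blob_radialCrossing_inter_le` — Step 1, for EVERY wired set `B` off the collar (it may meet the
  core): if the collar measure `φ^{Annᶜ}_{⟨EA⟩}` gives the radial crossing probability `≤ 1 - c`,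
  then `φ^B_{⟨E⟩}(Cross ∩ F) ≤ (1 - c) φ^B_{⟨E⟩}(F)` for every `F` determined inside the core
  (cylinder decomposition over the genuine collar edges + conditional domination,
  `rcMeasure_real_inter_cylinder_le_mul_fromEdgeSet`).
* `blob_inter_explEvent_empty_eq_mul` — the CLOSED-CUT domain Markov property
  (`RandomClusterClosedCut.lean`) at the explored set `X` of an exploration with EMPTY rim, for an
  arbitrary wired set `B`: conditionally on `{𝒞 = X, 𝒟 = ∅}` the unexplored configuration is the
  random-cluster configuration of the edges off `X` with wired set `B ∖ X`.
* `blob_union_sdiff_explSet_eq`, `blob_compl_radialCrossing_subset_iUnion`,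
  `blob_sum_explEvent_empty_eq` — bookkeeping of the outside-in exploration of the collar
  (`Rest = (Core ∪ Ann)ᶜ` explores `Ann`): `(B₀ ∪ W) ∖ X = B₀` for `B₀ ⊆ Core`, `W ⊆ Rest`; off the
  crossing event the rim is empty (`radialCrossing_of_mem_explRim`); the datum events are disjoint.

Everything is proved; no definitions.

## References

* H. Kesten, The incipient infinite cluster in two-dimensional percolation, *Probab. Theory Related
  Fields* 73 (1986) 369–394: proof of Lemma (23), eq. (31); Lemma (29).
* G. Grimmett, *The Random-Cluster Model*, Springer (2006): Thm. (3.1)(a), Lemma (4.13),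
  Lemma (4.14).
* D. Basu, A. Sapozhnikov, Kesten's incipient infinite cluster and quasi-multiplicativity of crossing
  probabilities, *Electron. Commun. Probab.* 22 (2017) no. 26, §2.
-/

noncomputable section

open MeasureTheory Finset SimpleGraph
open Literature.Probability.Percolation (BondConfig openConnIn openGraph explSet explRim explEvent)

namespace Literature.Probability.LatticeModels

variable {V : Type*}

/-! ### Bookkeeping of the outside-in exploration of the collar -/

section Combinatorics

/-- In the collar setting with wired set `B₀ ∪ W` (`B₀ ⊆ Core`, `W ⊆ Rest = (Core ∪ Ann)ᶜ`), the
explored set `X` of the outside-in exploration of the collar swallows `W` and misses `B₀`: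
`(B₀ ∪ W) ∖ X = B₀`. [folklore] -/
theorem blob_union_sdiff_explSet_eq {Core Ann Rest W B₀ : Set V} (hCA : ∀ v ∈ Core, v ∉ Ann)
    (hRest : ∀ v, v ∈ Rest ↔ v ∉ Core ∧ v ∉ Ann) (hWR : W ⊆ Rest) (hB₀ : ∀ b ∈ B₀, b ∈ Core)
    {X : Set V} {ω₀ : BondConfig V} (hω₀ : explSet Rest Ann ω₀ = X) : (B₀ ∪ W) \ X = B₀ := by
  have hXsub : X ⊆ Rest ∪ Ann := hω₀ ▸ Percolation.explSet_subset Rest Ann ω₀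
  have hRX : Rest ⊆ X := hω₀ ▸ Percolation.subset_explSet Rest Ann ω₀
  ext b
  simp only [Set.mem_sdiff, Set.mem_union]
  constructor
  · rintro ⟨hb | hb, hbX⟩
    · exact hb
    · exact absurd (hRX (hWR hb)) hbX
  · intro hb
    refine ⟨Or.inl hb, fun hbX ↦ ?_⟩
    rcases hXsub hbX with hbR | hbA
    · exact ((hRest b).1 hbR).1 (hB₀ b hb)
    · exact hCA b (hB₀ b hb) hbA

/-- **Off the radial crossing event the outside-in exploration of the collar has empty rim**
(Kesten 1986, proof of Lemma (23): "no crossing ⇒ the exploration from outside stops inside the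
collar"), so on lattice configurations the complement of the crossing event is covered by the datum
events `{𝒞 = X, 𝒟 = ∅}`, `X` ranging over a finite set of candidates containing every explored set.
[cite: Kesten1986, proof of Lemma (23), eq. (31)] -/
theorem blob_compl_radialCrossing_subset_iUnion {E : Finset (Sym2 V)} {Core Ann Rest : Set V}
    (hCA : ∀ v ∈ Core, v ∉ Ann)
    (hCore : ∀ e ∈ E, (∃ v ∈ Core, v ∈ e) → ∀ x ∈ e, x ∈ Core ∨ x ∈ Ann)
    (hRest : ∀ v, v ∈ Rest ↔ v ∉ Core ∧ v ∉ Ann) (s : Finset (Set V))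
    (hs : ∀ ω : BondConfig V, explSet Rest Ann ω ∈ s) {A : Set (BondConfig V)} {ω : BondConfig V}
    (hω : ω ⊆ (fromEdgeSet (E : Set (Sym2 V))).edgeSet)
    (hωA : ω ∈ A ∩ {ω : BondConfig V | ∃ (a b : V) (w : (fromEdgeSet (E : Set (Sym2 V))).Walk a b),
      a ∈ Core ∧ b ∉ Core ∪ Ann ∧ (∀ z ∈ w.support, z = a ∨ z = b ∨ z ∈ Ann) ∧
        ∀ e ∈ w.edges, e ∈ ω}ᶜ) :
    ω ∈ ⋃ X ∈ s, (A ∩ explEvent Rest Ann X ∅) := by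
  refine Set.mem_iUnion₂.2 ⟨explSet Rest Ann ω, hs ω, hωA.1, rfl, ?_⟩
  exact Set.eq_empty_of_forall_notMem fun r hr ↦
    hωA.2 (radialCrossing_of_mem_explRim hCA hCore hRest hω hr)

end Combinatorics

section Finite

variable [Fintype V]

/-- The datum events `{𝒞 = X, 𝒟 = ∅}` are pairwise disjoint, so their probabilities — and those of
their traces on any event `A` — add up over any finite set of candidates `X`.
[cite: BasuSapozhnikov2017ECP, §2 ("F_i = ∪ F_i(U,R)", disjoint union)] -/
theorem blob_sum_explEvent_empty_eq (μ : Measure (BondConfig V)) [IsFiniteMeasure μ]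
    (In Blk : Set V) (s : Finset (Set V)) (A : Set (BondConfig V)) :
    ∑ X ∈ s, μ.real (A ∩ explEvent In Blk X ∅) = μ.real (⋃ X ∈ s, (A ∩ explEvent In Blk X ∅)) :=
  (measureReal_biUnion_finset (fun X _ Y _ hXY ↦
    (Percolation.disjoint_explEvent fun h ↦ hXY (congrArg Prod.fst h)).mono
      Set.inter_subset_right Set.inter_subset_right)
    fun _ _ ↦ MeasurableSet.of_discrete).symm

variable [DecidableEq V]

/-! ### Step 2 input: the closed cut at the explored set of an exploration with empty rim -/

/-- **Domain Markov at the explored set of an exploration with EMPTY rim, arbitrary wired set**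
(Grimmett 2006, Thm. (3.1)(a) and Lemma (4.13), across a closed vertex cut; Kesten 1986, proof of
Lemma (23)): on the datum event `{𝒞 = X, 𝒟 = ∅}` of the exploration of `Blk` from `In` no open edge
leaves `X`, so for the region `U` of the edges of `G` with both endpoints off `X` and ANY wired set
`B` of the ambient measure,
`φ^B_G({ω ∩ U ∈ A} ∩ {𝒞 = X, 𝒟 = ∅}) = φ^B_G({𝒞 = X, 𝒟 = ∅}) · φ^{B ∖ X}_{⟨U⟩}(A)` for every event
`A` (`0 ≤ p ≤ 1`, `q > 0`): conditionally on the exploration, the unexplored configuration is the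
random-cluster configuration of `⟨U⟩` wired on `B ∖ X` only. [cite: Grimmett2006, Lemma (4.13)] -/
theorem blob_inter_explEvent_empty_eq_mul (G : SimpleGraph V) [DecidableRel G.Adj] {p q : ℝ}
    (hp : p ∈ Set.Icc (0 : ℝ) 1) (hq : 0 < q) (B : Set V) {In Blk : Set V} (X : Set V)
    (U : Finset (Sym2 V)) (hU : ∀ e, e ∈ U ↔ e ∈ G.edgeSet ∧ ∀ x ∈ e, x ∉ X)
    (A : Set (BondConfig V)) :
    (rcMeasure G p q B).real ({ω | ω ∩ ↑U ∈ A} ∩ explEvent In Blk X ∅) =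
      (rcMeasure G p q B).real (explEvent In Blk X ∅) *
        (rcMeasure (fromEdgeSet (U : Set (Sym2 V))) p q (B \ X)).real A := by
  refine rcMeasure_real_inter_eq_mul_fromEdgeSet_of_closed_cut G hp hq B X U
    (fun e he ↦ mem_edgeFinset.2 ((hU e).1 he).1) (fun e he x hx ↦ ((hU e).1 he).2 x hx)
    _ (fun ω₁ ω₂ h ↦ ?_) ?_ A
  · refine Percolation.mem_explEvent_iff_of_agree_on_touching fun e ⟨v, hv, hve⟩ ↦ ?_
    have heU : e ∈ (↑U : Set (Sym2 V))ᶜ := fun heU ↦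
      ((hU e).1 (Finset.mem_coe.1 heU)).2 v hve hv
    constructor
    · intro h1
      have h' : e ∈ ω₁ ∩ (↑U : Set (Sym2 V))ᶜ := ⟨h1, heU⟩
      rw [h] at h'
      exact h'.1
    · intro h2
      have h' : e ∈ ω₂ ∩ (↑U : Set (Sym2 V))ᶜ := ⟨h2, heU⟩
      rw [← h] at h'
      exact h'.1
  · intro ζ hζ hζF e he x hx
    by_contra hxX
    have heE := Finset.mem_sdiff.1 (hζ he)
    have hex : ∃ y ∈ e, y ∈ X := by
      by_contra hne
      push Not at hne
      exact heE.2 ((hU e).2 ⟨mem_edgeFinset.1 heE.1, hne⟩)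
    obtain ⟨y, hye, hyX⟩ := hex
    have hxy : x ≠ y := fun h ↦ hxX (h ▸ hyX)
    have he_eq : e = s(x, y) := (Sym2.mem_and_mem_iff hxy).1 ⟨hx, hye⟩
    have hyx : s(y, x) ∈ (↑ζ : BondConfig V) := by
      rw [Sym2.eq_swap, ← he_eq]
      exact Finset.mem_coe.2 he
    exact (Set.notMem_empty x) (Percolation.mem_of_mem_explEvent_of_open_edge hζF hyX hyx hxX)

/-! ### Step 1: an inner event does not help the radial crossing -/

/-- **An inner event does not help the radial crossing, for every wired set off the collar**
(Kesten 1986, proof of Lemma (23), eq. (31), with Grimmett 2006, Lemma (4.13)–(4.14)(b)). If the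
collar measure wired outside the collar gives the open radial crossing probability `≤ 1 - c`, then
for every event `F` determined by the `E`-edges inside the core and every wired set `B` off the
collar `Ann` (it may meet the core, e.g. `B = B₀ ∪ W` with a blob `B₀ ⊆ Core`),
`φ^B_{⟨E⟩}(Cross ∩ F) ≤ (1 - c) φ^B_{⟨E⟩}(F)`: decompose `F` along the cylinders of the region of
genuine collar edges; on each cylinder the crossing (increasing, determined on the collar edges) is
dominated by its probability under the collar measure wired on `Annᶜ`, which contains `B` and the
endpoints of the frozen open edges. [cite: Kesten1986, proof of Lemma (23), eq. (31)] -/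
theorem blob_radialCrossing_inter_le : ∀ {V : Type*} [Fintype V] [DecidableEq V] {p q : ℝ}, p ∈ Set.Icc (0 : ℝ) 1 → 1 ≤ q → ∀ (E EA : Finset (Sym2 V)) (Core Ann B : Set V), (∀ v ∈ Core, v ∉ Ann) → (∀ b ∈ B, b ∉ Ann) → (∀ e ∈ E, (∃ v ∈ Core, v ∈ e) → ∀ x ∈ e, x ∈ Core ∨ x ∈ Ann) → (∀ e, e ∈ EA ↔ e ∈ E ∧ ∃ v ∈ Ann, v ∈ e) → ∀ {c : ℝ}, (Literature.Probability.LatticeModels.rcMeasure (SimpleGraph.fromEdgeSet (EA : Set (Sym2 V))) p q Annᶜ).real {ω | ∃ (a b : V) (w : (SimpleGraph.fromEdgeSet (E : Set (Sym2 V))).Walk a b), a ∈ Core ∧ b ∉ Core ∪ Ann ∧ (∀ z ∈ w.support, z = a ∨ z = b ∨ z ∈ Ann) ∧ ∀ e ∈ w.edges, e ∈ ω} ≤ 1 - c → ∀ {F : Set (Literature.Probability.Percolation.BondConfig V)}, (∀ ω₁ ω₂ : Literature.Probability.Percolation.BondConfig V, (∀ e ∈ E, (∀ x ∈ e, x ∈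 Core) → (e ∈ ω₁ ↔ e ∈ ω₂)) → (ω₁ ∈ F ↔ ω₂ ∈ F)) → (Literature.Probability.LatticeModels.rcMeasure (SimpleGraph.fromEdgeSet (E : Set (Sym2 V))) p q B).real ({ω | ∃ (a b : V) (w : (SimpleGraph.fromEdgeSet (E : Set (Sym2 V))).Walk a b), a ∈ Core ∧ b ∉ Core ∪ Ann ∧ (∀ z ∈ w.support, z = a ∨ z = b ∨ z ∈ Ann) ∧ ∀ e ∈ w.edges, e ∈ ω} ∩ F) ≤ (1 - c) * (Literature.Probability.LatticeModels.rcMeasure (SimpleGraph.fromEdgeSet (E : Set (Sym2 V))) p q B).real F := by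
  intro V _ _ p q hp hq E EA Core Ann B hCA hB hCore hEA c hcross F hF
  classical
  have hq0 : 0 < q := one_pos.trans_le hq
  have hEfin := mem_edgeFinset_fromEdgeSet_iff E
  -- the region: the genuine collar edges
  set U : Finset (Sym2 V) := EA.filter (fun e ↦ ¬ e.IsDiag) with hUdef
  have hUmem : ∀ e, e ∈ U ↔ e ∈ EA ∧ ¬ e.IsDiag := fun e ↦ Finset.mem_filter
  have hGU : fromEdgeSet (U : Set (Sym2 V)) = fromEdgeSet (EA : Set (Sym2 V)) := by
    ext u v
    simp only [fromEdgeSet_adj, Finset.mem_coe, hUmem, Sym2.mk_isDiag_iff]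
    tauto
  -- `F` is determined off `U`
  have hF' : ∀ ω₁ ω₂ : BondConfig V, ω₁ ∩ (↑U)ᶜ = ω₂ ∩ (↑U)ᶜ → (ω₁ ∈ F ↔ ω₂ ∈ F) := by
    intro ω₁ ω₂ h
    refine hF ω₁ ω₂ fun e _ heC ↦ ?_
    have heU : e ∈ (↑U : Set (Sym2 V))ᶜ := by
      intro heU
      obtain ⟨heA, -⟩ := (hUmem e).1 (Finset.mem_coe.1 heU)
      obtain ⟨-, v, hvA, hve⟩ := (hEA e).1 heA
      exact hCA v (heC v hve) hvA
    constructor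
    · intro h1
      have h' : e ∈ ω₁ ∩ (↑U : Set (Sym2 V))ᶜ := ⟨h1, heU⟩
      rw [h] at h'
      exact h'.1
    · intro h2
      have h' : e ∈ ω₂ ∩ (↑U : Set (Sym2 V))ᶜ := ⟨h2, heU⟩
      rw [← h] at h'
      exact h'.1
  refine rcMeasure_real_inter_le_mul_of_cylinder_le (fromEdgeSet (E : Set (Sym2 V))) hp hq0 B U hF'
    fun ξ hξ ↦ ?_
  -- on a cylinder: conditional domination by the collar measure wired outside the collar
  have hξW : ∀ e ∈ (↑ξ : Set (Sym2 V)), ∀ x ∈ e, x ∈ Annᶜ := by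
    intro e he x hx hxA
    obtain ⟨heG, heU⟩ := Finset.mem_sdiff.1 (hξ (Finset.mem_coe.1 he))
    obtain ⟨heE, hnd⟩ := (hEfin _ e).1 heG
    exact heU ((hUmem e).2 ⟨(hEA e).2 ⟨heE, x, hxA, hx⟩, hnd⟩)
  have h1 := rcMeasure_real_inter_cylinder_le_mul_fromEdgeSet (fromEdgeSet (E : Set (Sym2 V))) hp hq
    B U (fun e he ↦ (hEfin _ e).2 ⟨((hEA e).1 ((hUmem e).1 he).1).1, ((hUmem e).1 he).2⟩) (↑ξ)
    (W := Annᶜ) hB hξW (isUpperSet_radialCrossing E Core Ann)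
  have h2 : {ω : BondConfig V | ω ∩ ↑U ∈ {ω : BondConfig V | ∃ (a b : V)
      (w : (fromEdgeSet (E : Set (Sym2 V))).Walk a b), a ∈ Core ∧ b ∉ Core ∪ Ann ∧
        (∀ z ∈ w.support, z = a ∨ z = b ∨ z ∈ Ann) ∧ ∀ e ∈ w.edges, e ∈ ω}} =
      {ω : BondConfig V | ∃ (a b : V) (w : (fromEdgeSet (E : Set (Sym2 V))).Walk a b),
        a ∈ Core ∧ b ∉ Core ∪ Ann ∧ (∀ z ∈ w.support, z = a ∨ z = b ∨ z ∈ Ann) ∧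
          ∀ e ∈ w.edges, e ∈ ω} := by
    ext ω
    refine ⟨fun h ↦ isUpperSet_radialCrossing E Core Ann Set.inter_subset_left h, fun h ↦ ?_⟩
    refine inter_mem_radialCrossing hCore (fun e heE hnd ht ↦ ?_) h
    exact Finset.mem_coe.2 ((hUmem e).2 ⟨(hEA e).2 ⟨heE, ht⟩, hnd⟩)
  rw [h2] at h1
  refine h1.trans ?_
  rw [mul_comm]
  refine mul_le_mul_of_nonneg_right ?_ measureReal_nonneg
  rw [rcMeasure_congr_graph hGU]
  exact hcross

end Finite

end Literature.Probability.LatticeModels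

end
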